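import Literature.Barriers.Parity.SiegelZeroDichotomy
import HarnessLib

/-!
# Chowla's `k`-point correlations in the presence of a Landau–Siegel zero (Jaskari–Sachpazis 2025)

Topic `Literature/NumberTheory/LFunctions` (namespace `Literature.NumberTheory.LFunctions`).
STATEMENT LAYER for the cell `parity-realchar` (SIEGEL INSTRUMENT, D-0070 deliverable (3), topic I.5
"Chowla / Liouville correlations" — an additional PUBLISHED source next to Tao–Teräväinen 2022,
Corollary 1.8 (ii), typed in the tree as `Literature.Barriers.Parity.TaoTeravainen2021_chowla`).
Source: M. Jaskari, S. Sachpazis, Math. Proc. Cambridge Philos. Soc. (2025),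
doi:10.1017/s0305004125000271 (title in `references.bib` [JaskariSachpazis2024]), §1 Theorem 1.1
and Corollary 1.2 (held copy arXiv:2409.10663, p. 3–4), read from the held text.

Objects (the tree's, unchanged): a Landau–Siegel zero of quality `η ≥ 10` of a primitive quadratic `χ`
mod `q`, `β = 1 − 1/(η log q)` — `Literature.Barriers.Parity.IsSiegelZero χ η` (Tao–Teräväinen's
Definition 1.4, which is verbatim the paper's hypothesis "a real zero `β = 1 − 1/(η log q)` with
`η ≥ 10`"); the correlation average `(1/x) ∑_{n ≤ x} ∏_{h ∈ H} λ(n + h)` —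
`Literature.Barriers.Parity.liouvilleTupleAverage H x` (average over `1 ≤ n ≤ x`, `x : ℕ`); the
"`k ≥ 2` distinct non-negative integers `h₁, …, h_k`" are a `Finset ℕ` of cardinality `≥ 2`. The
paper's `x = q^V`, `V ∈ [1/2 + ε, η]`, is rendered for natural `x` with `V := log x / log q` and the
range `q^{1/2+ε} ≤ x ≤ q^η`; the bounds `≪ x(…)` are divided by `x`. "The implicit constants in
Theorem 1.1 and Corollary 1.2 depend on `ε, k` and the shifts" — one constant `K` per `(H, ε)`.

* `jaskariSachpazis2025_theorem11` — **Theorem 1.1**: `∑_{n≤x} λ(n+h₁)⋯λ(n+h_k) ≪ xV/η + x exp(−c√(V log η))`.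
* `jaskariSachpazis2025_corollary12` — **Corollary 1.2**: (i) `≪ x exp(−c′√(log η))` on
  `[q^{1/2+ε}, q^{c^{−2} log η}]`; (ii) `≪_δ x/η^{1−δ}` on `(q^{c^{−2} log η}, q^{η^δ}]`, every `δ ∈ (0,1)`.
Both NAMED FACTS as printed, not proved here ("improve the result of Tao and Teräväinen in both
directions": the bound `(log η)^{−1/10}` and the range `q^{η^{1/2}}`). No new hypothesis shape: the
antecedent is the column's `IsSiegelZero`. WHAT THIS IS NOT: nothing about the existence of such
zeros; no `k = 1` statement; nothing here bears on parity. No instances, no notation.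
-/

noncomputable section

open scoped Classical

namespace Literature.NumberTheory.LFunctions

open Literature.Barriers.Parity

/-- **Jaskari–Sachpazis 2025, Theorem 1.1 (NAMED FACT, as printed).** "Let `q ≥ 2` be a positive
integer and let `χ` be a primitive quadratic character modulo `q` such that `L(·,χ)` has a real zero
`β = 1 − 1/(η log q)` with `η ≥ 10`. We also fix an integer `k ≥ 2`, distinct non-negative integers
`h₁, …, h_k`, and `ε ∈ (0, 1/2)`. There exists a constant `c = c(ε,k) > 0` such that for `x = q^V`
with `V ∈ [1/2 + ε, η]`, we have `∑_{n ≤ x} λ(n+h₁)⋯λ(n+h_k) ≪ xV/η + x exp(−c √(V log η))`."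
Rendered on the tree's objects: for every finite set `H` of shifts with `|H| ≥ 2` and every
`ε ∈ (0, 1/2)` there are `c > 0` and `K > 0` such that for every `q ≥ 2`, every Siegel zero
`IsSiegelZero χ η` mod `q` and every natural `x` with `q^{1/2+ε} ≤ x ≤ q^η`, writing `V = log x/log q`:
`|liouvilleTupleAverage H x| ≤ K (V/η + exp(−c √(V log η)))`. Not proved here.
[cite: JaskariSachpazis2024, Theorem 1.1] -/
def jaskariSachpazis2025_theorem11 : Prop :=
  ∀ H : Finset ℕ, 2 ≤ H.card → ∀ ε : ℝ, 0 < ε → ε < 1 / 2 →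
    ∃ c : ℝ, 0 < c ∧ ∃ K : ℝ, 0 < K ∧
      ∀ (q : ℕ) [NeZero q], 2 ≤ q → ∀ (χ : DirichletCharacter ℂ q) (η : ℝ), IsSiegelZero χ η →
        ∀ x : ℕ, (q : ℝ) ^ ((1 : ℝ) / 2 + ε) ≤ x → (x : ℝ) ≤ (q : ℝ) ^ η →
          |liouvilleTupleAverage H x| ≤
            K * (Real.log x / Real.log q / η +
              Real.exp (-(c * Real.sqrt (Real.log x / Real.log q * Real.log η))))

/-- **Jaskari–Sachpazis 2025, Corollary 1.2 (NAMED FACT, as printed).** "Let `q, η, k` and `ε` be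
as in the statement of Theorem 1.1. Let also `c` be the constant from the bound of Theorem 1.1 and
consider distinct fixed integers `h₁, …, h_k ≥ 0`. • There exists a constant `c′ = c′(ε,k) > 0` such
that `∑_{n≤x} λ(n+h₁)⋯λ(n+h_k) ≪ x exp(−c′√(log η))` for every `x ∈ [q^{1/2+ε}, q^{c^{−2} log η}]`.
• For every `δ ∈ (0,1)`, we have that `∑_{n≤x} λ(n+h₁)⋯λ(n+h_k) ≪_δ x/η^{1−δ}` for all
`x ∈ (q^{c^{−2} log η}, q^{η^δ}]`." Rendered: for every `H` with `|H| ≥ 2` and `ε ∈ (0,1/2)` there is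
`c > 0` (the exponent scale of Theorem 1.1) such that (i) for some `c′, K > 0`, on
`q^{1/2+ε} ≤ x ≤ q^{c^{−2} log η}`: `|liouvilleTupleAverage H x| ≤ K exp(−c′ √(log η))`; and (ii) for
every `δ ∈ (0,1)` there is `K_δ > 0` with `|liouvilleTupleAverage H x| ≤ K_δ / η^{1−δ}` on
`q^{c^{−2} log η} < x ≤ q^{η^δ}`. Not proved here. [cite: JaskariSachpazis2024, Corollary 1.2] -/
def jaskariSachpazis2025_corollary12 : Prop :=
  ∀ H : Finset ℕ, 2 ≤ H.card → ∀ ε : ℝ, 0 < ε → ε < 1 / 2 →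
    ∃ c : ℝ, 0 < c ∧
      (∃ c' : ℝ, 0 < c' ∧ ∃ K : ℝ, 0 < K ∧
        ∀ (q : ℕ) [NeZero q], 2 ≤ q → ∀ (χ : DirichletCharacter ℂ q) (η : ℝ), IsSiegelZero χ η →
          ∀ x : ℕ, (q : ℝ) ^ ((1 : ℝ) / 2 + ε) ≤ x →
            (x : ℝ) ≤ (q : ℝ) ^ (c ^ (-(2 : ℝ)) * Real.log η) →
              |liouvilleTupleAverage H x| ≤ K * Real.exp (-(c' * Real.sqrt (Real.log η)))) ∧
      (∀ δ : ℝ, 0 < δ → δ < 1 → ∃ K : ℝ, 0 < K ∧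
        ∀ (q : ℕ) [NeZero q], 2 ≤ q → ∀ (χ : DirichletCharacter ℂ q) (η : ℝ), IsSiegelZero χ η →
          ∀ x : ℕ, (q : ℝ) ^ (c ^ (-(2 : ℝ)) * Real.log η) < x → (x : ℝ) ≤ (q : ℝ) ^ (η ^ δ) →
            |liouvilleTupleAverage H x| ≤ K / η ^ (1 - δ))

/-! ### Bookkeeping (proved) -/

/-- The second bullet of Corollary 1.2 at `δ = 1/2` covers the upper end `q^{√η}` of
Tao–Teräväinen's window with the bound `K/√η` (the tree's `TaoTeravainen2021_chowla` has
`C/(log η)^{1/10}` there); recorded as the specialisation `δ = 1/2` (`η^{1/2} = √η`,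
`η^{1−1/2} = √η`). [cite: JaskariSachpazis2024, Corollary 1.2] -/
theorem jaskariSachpazis2025_corollary12_half (h : jaskariSachpazis2025_corollary12) (H : Finset ℕ)
    (hH : 2 ≤ H.card) {ε : ℝ} (hε0 : 0 < ε) (hε : ε < 1 / 2) :
    ∃ c : ℝ, 0 < c ∧ ∃ K : ℝ, 0 < K ∧
      ∀ (q : ℕ) [NeZero q], 2 ≤ q → ∀ (χ : DirichletCharacter ℂ q) (η : ℝ), IsSiegelZero χ η →
        ∀ x : ℕ, (q : ℝ) ^ (c ^ (-(2 : ℝ)) * Real.log η) < x → (x : ℝ) ≤ (q : ℝ) ^ Real.sqrt η →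
          |liouvilleTupleAverage H x| ≤ K / Real.sqrt η := by
  obtain ⟨c, hc, -, h2⟩ := h H hH ε hε0 hε
  obtain ⟨K, hK, hb⟩ := h2 (1 / 2) one_half_pos (by norm_num)
  refine ⟨c, hc, K, hK, fun q _ hq χ η hS x hlo hhi => ?_⟩
  have hη : 0 ≤ η := le_trans (by norm_num) hS.ten_le
  have h1 : η ^ ((1 : ℝ) / 2) = Real.sqrt η := (Real.sqrt_eq_rpow η).symm
  have h2' : η ^ (1 - (1 : ℝ) / 2) = Real.sqrt η := by norm_num [h1]
  have := hb q hq χ η hS x hlo (by rwa [h1])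
  rwa [h2'] at this

end Literature.NumberTheory.LFunctions

end
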